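import Summits.QuantumFields.YangMills.Theorems.BalabanUVNodesN22GenSchemasOfAnalyticReading
import Summits.QuantumFields.YangMills.Theorems.BalabanUVNodesN22AtRecordOfGenStepRecursion

/-!
# BalabanUVNodes ∕ node N22 = NE9 — ROAD 2 AT THE RECORD FROM THE ANALYTIC READING OF node00-def-W1's ONE-STEP MAP: K3's `h9`
# `NE9 ((objectsOfRecord₁₃ F N θ ℓ).EA 0) (Window θ.γ) ℓ.κ ℓ.moduli`, the kernel-face socket and the pin face from node N18's kernel step rate + ANALYTICITY WITH A MARGIN
# in the older terms (module J57) + last-coupling regularity + the output bound — dag-n22-a's second-order older-term schema no longer an input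

Cell `pub-ymgap`, HUMAN RULING D-0062 (Track A), R134 seat `pub-ymgap-dag-n22-c` (strategy s1), generation 18, module J58.  THEOREMS ONLY (no `def`, no `sorry`, standard axioms);
`--kind proof --supports stmt-QuantumFields-27366 --as helper` (K3⁸ `SpineGivenEndpointR13SepCoPHV`), COUNT-NEUTRAL.  Imports module J57 `…N22GenSchemasOfAnalyticReading`
(`genT1_of_analyticReading`, `genT2old_of_analyticReading`; through it J53) and module J54 `…N22AtRecordOfGenStepRecursion` (its §1 `h9` producer in generator currency, dag-n22-w3's
socket `n22At_u3OfRecord₁₃_objectsOfRecord₁₃_iff` and pin form `n22At_rateCarriers_of_kernels_pin_of_ne9`).  Nothing re-declared; §1–§3 are ONE application of J54 each, with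
J54's schema binders `hG1` ∕ `hG2old` and channel rows `ha` ∕ `hb` DISCHARGED from the analytic reading.

WHY.  Module J54 keyed K3's `h9` to node N18's letter + THREE one-step-map schemas (G-T1), (G-T2-last), (G-T2-old) on def-W1's generator.  Module J57 derives (G-T1)'s
older-term part and the whole second-order schema (G-T2-old) from ONE binder — the ANALYTIC READING (AR): per torus `K` and step `k` a complex normed space `Pot K k`, a reading
`ρA K k : OlderTerms → Pot K k` and `A K k t φ X : Pot K k → ℂ` with (AR-fact) factorization on `Adm K k`, (AR-holo) holomorphy and the bound `M_b·e^{−κ_E d}` on `ball 0 R`,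
(AR-adm) admissible families read into `closedBall 0 r₀`, `r₀ + ϱ < R`, (AR-dom₁)∕(AR-dom₂) sup-type domination of read first ∕ second differences of admissible families by the
decay-weighted table entries with age weights `aw K k j` (`0 ≤ aw ≤ c_w·ω₁^{k−j}`, `aw K k 0 = 0`) — pub-balaban's `T4HistoryLipschitzOuter` §4–§5 binder shape («analyticity +
size on a complex domain with a margin», [II] (2.14)–(2.15) p. 15) at def-W1's generator.  So at the record (THIS FILE) ROAD 2's inputs are: N18's letter; (AR); the LAST-coupling
schemas (G-T1-last), (G-T2-last) ([I] p. 263: C^∞ in the last coupling, (1.17)); (Adm-run); the output bound ∕ readings ∕ tails ∕ law ∕ (1.21); and the rows of J54 read at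
`c = 4M_b c_w∕ϱ`, `c_b = 64M_b c_w²∕ϱ²` — in particular `ℓ.θ₅·ν ≤ ℓ.ω²` with `ν > ω₁ + 4M_b c_w∕ϱ`, `ν ≥ (ω₁ + 4M_b c_w∕ϱ)²`, `ν ≥ 1`: N18's UV rate against the growth forced by
the ANALYTICITY MARGIN (pub-balaban's «lower bounds on the analyticity radius in units of the channel weight», `fade_of_radius` ∕ `nonexpansive_of_radius`, now on ROAD 2).
§0 (ns `YMDAG.N22.TermRecursion`) ★★ `termSecondDiffAt_box_truncRun_toClusterTower_of_analyticReading` — J53's term-level letter (table `L₂·ν^{k−i}`) for def-W1's run towers from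
(AR) + last-coupling schemas + (Adm-run); §1 ★★★ `ne9_EA_objectsOfRecord₁₃_of_kernelStepRate_genAnalyticReading` — K3's `h9`; §2 ★★★ the kernel-face socket
`n22At_u3OfRecord₁₃_of_kernelStepRate_genAnalyticReading`; §3 ★★★ the pin face `n22At_rateCarriers_of_kernels_pin_of_kernelStepRate_genAnalyticReading`.

HONEST FRAMING (binding).  Count-neutral COMPOSITION of landed theorems by name; (AR), the last-coupling schemas, (Adm-run), N18's letter, the output bound, the readings ∕ tails,
W1-20's law and (1.21) are DISPLAYED HYPOTHESES ((AR) = the cell's reading, NOT printed for the older terms as independent variables — GAPS G-ne9p2-5; producer: node N10 ∕ NODE A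
on def-T's generator of record; inhabited by every generator ignoring `old` — A5, conditional content); NO estimate of Bałaban's is proved or asserted; nothing of the record is
constructed or claimed to meet the displayed inputs.  N22 is NOT discharged (typed 28∕28 · discharged 5∕27 UNCHANGED); K3⁸ OPEN and NOT claimed; NE9 is NOT IN PRINT for d = 4;
one finite 𝕋⁴ programme at fixed ε — R4 closes the CONDITIONAL rung `BalabanLadder.UV` only; NOTHING about the continuum limit, ℝ⁴, infinite volume, OS axioms, a mass gap or
the Clay problem is proved or claimed.  References (TYPES only): [I] = Bałaban, CMP 109 (1987) (0.23) p. 256, (1.17)–(1.18) p. 263, (2.12)–(2.13) p. 268, p. 282, §5 p. 298;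
[II] = CMP 116 (1988) (1.41) p. 11, (2.13)–(2.15) pp. 14–15, p. 18, (2.41) p. 21; King, CMP 102 (1986) Lemma 4.5 (4.38).
-/

noncomputable section

open Set Metric
open scoped BigOperators

namespace YMDAG.N22.TermRecursion

open Literature.MathematicalPhysics.QuantumFieldTheory.Balaban1983to89
open Literature.MathematicalPhysics.QuantumFieldTheory.Balaban1983to89.T4OutputRate (Window)
open Literature.MathematicalPhysics.QuantumFieldTheory.Balaban1983to89.Node00.Sect2 (domSys CPair)
open Literature.MathematicalPhysics.QuantumFieldTheory.Balaban1983to89.Node00.W1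

section Gen

variable {P : Params} {𝔸 : Type} {M : ℕ} (G : GenTower P 𝔸 M) (sp : (k : ℕ) → (domSys P M (k + 1)).Dom → Set (CPair P 𝔸))
  (Adm : (k : ℕ) → OlderTerms P 𝔸 M k → Prop)
  {Pot : ℕ → Type*} [∀ k, NormedAddCommGroup (Pot k)] [∀ k, NormedSpace ℂ (Pot k)]
  (ρ : (k : ℕ) → OlderTerms P 𝔸 M k → Pot k) (A : (k : ℕ) → ℝ → CPair P 𝔸 → (domSys P M (k + 1)).Dom → Pot k → ℂ)
/-! ## §0 ★★ The term-level second-difference letter for node00-def-W1's run towers from the analytic reading -/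

open Finset in
/-- ★★ **THE TERM-LEVEL SECOND-DIFFERENCE LETTER FOR THE RUN TOWERS `truncRun K (toClusterTower G)` FROM THE ANALYTIC READING.**  The analytic reading (factorization `hGA`,
holomorphy `hA`, bound `hMb`, admissible radius `hAdmr`, reading dominations `hρ₁`∕`hρ₂`, level weights `0 ≤ w k j ≤ c_w·ω₁^{k−j}`, `w k 0 = 0`, `ω₁ ≤ 1`) + the LAST-coupling schemas
(G-T1-last) (`lam ≤ ℓ₁`) and (G-T2-last) (`lam₂ ≤ ℓ₂`) + (Adm-run) + a growth rate `ν > ω₁ + c`, `ν ≥ (ω₁ + c)²` at **`c = 4M_b c_w∕ϱ`** ⟹ module J53's letter for every run length `K`: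
**`‖E^{(k+1)}(X; g∣g_i:=t+d) − 2E^{(k+1)}(X; g∣g_i:=t) + E^{(k+1)}(X; g∣g_i:=t−d)‖ ≤ L₂·ν^{k−i}·e^{−κd_{k+1}(X)}·d²`**, `L₂ = max ℓ₂ (c_b ℓ₁²∕(ν − ω₁ − c))`, **`c_b = 64M_b c_w²∕ϱ²`** —
§2 into J53's `termSecondDiffAt_box_truncRun_toClusterTower_of_genStepRecursion` (channels `a = (4M_b∕ϱ)·w ≤ c·ω₁^{k−j}`, `b = (64M_b∕ϱ²)·w² ≤ c_b·ω₁^{k−j}` as `ω₁ ≤ 1`). [folklore] -/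
theorem termSecondDiffAt_box_truncRun_toClusterTower_of_analyticReading (hsp : ∀ k X, (sp k X).Nonempty) {γ κ R r₀ ϱ Mb ℓ₁ ℓ₂ cw ω₁ ν : ℝ} {w : ℕ → ℕ → ℝ}
    {lam lam₂ : ℕ → ℝ} (hγ : 0 < γ) (hϱ : 0 < ϱ) (hR : r₀ + ϱ < R) (hMb0 : 0 ≤ Mb)
    (hGA : ∀ (k : ℕ), ∀ t ∈ Ioc (0 : ℝ) γ, ∀ (old : OlderTerms P 𝔸 M k), Adm k old → ∀ (X : (domSys P M (k + 1)).Dom), ∀ φ ∈ sp k X,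
      (G k).E ((t : ℝ) : ℂ) old φ X = A k t φ X (ρ k old))
    (hA : ∀ (k : ℕ), ∀ t ∈ Ioc (0 : ℝ) γ, ∀ (X : (domSys P M (k + 1)).Dom), ∀ φ ∈ sp k X, DifferentiableOn ℂ (A k t φ X) (ball 0 R))
    (hMb : ∀ (k : ℕ), ∀ t ∈ Ioc (0 : ℝ) γ, ∀ (X : (domSys P M (k + 1)).Dom), ∀ φ ∈ sp k X, ∀ p ∈ ball (0 : Pot k) R,
      ‖A k t φ X p‖ ≤ Mb * Real.exp (-(κ * (domSys P M (k + 1)).dj X)))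
    (hAdmr : ∀ (k : ℕ) (old : OlderTerms P 𝔸 M k), Adm k old → ‖ρ k old‖ ≤ r₀)
    (hρ₁ : ∀ (k : ℕ) (o o' : OlderTerms P 𝔸 M k), Adm k o → Adm k o' → ∀ (B : ℝ), 0 ≤ B →
      (∀ (k' : ℕ) (hk' : k' < k) (Y : (domSys P M (k' + 1)).Dom), ∀ φ' ∈ sp k' Y,
        w k (k' + 1) * (Real.exp (κ * (domSys P M (k' + 1)).dj Y) * ‖o ⟨k' + 1, Nat.succ_lt_succ hk'⟩ Y φ' - o' ⟨k' + 1, Nat.succ_lt_succ hk'⟩ Y φ'‖) ≤ B) →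
      ‖ρ k o - ρ k o'‖ ≤ B)
    (hρ₂ : ∀ (k : ℕ) (o₁ o₂ o₃ : OlderTerms P 𝔸 M k), Adm k o₁ → Adm k o₂ → Adm k o₃ → ∀ (B : ℝ), 0 ≤ B →
      (∀ (k' : ℕ) (hk' : k' < k) (Y : (domSys P M (k' + 1)).Dom), ∀ φ' ∈ sp k' Y,
        w k (k' + 1) * (Real.exp (κ * (domSys P M (k' + 1)).dj Y) *
          ‖o₁ ⟨k' + 1, Nat.succ_lt_succ hk'⟩ Y φ' - 2 * o₂ ⟨k' + 1, Nat.succ_lt_succ hk'⟩ Y φ' + o₃ ⟨k' + 1, Nat.succ_lt_succ hk'⟩ Y φ'‖) ≤ B) →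
      ‖ρ k o₁ - (2 : ℂ) • ρ k o₂ + ρ k o₃‖ ≤ B)
    (hw : ∀ k j, 0 ≤ w k j) (hw0 : ∀ k, w k 0 = 0) (hwω : ∀ k j, j ≤ k → w k j ≤ cw * ω₁ ^ (k - j)) (hcw : 0 ≤ cw) (hω₁ : 0 ≤ ω₁) (hω₁1 : ω₁ ≤ 1)
    (hAdm : ∀ g ∈ Window γ, ∀ k, Adm k (olderOf (recTerm G fun n => ((g n : ℝ) : ℂ)) k))
    (hGt : ∀ (k : ℕ), ∀ t ∈ Ioc (0 : ℝ) γ, ∀ t' ∈ Ioc (0 : ℝ) γ, ∀ (old : OlderTerms P 𝔸 M k), Adm k old → ∀ (X : (domSys P M (k + 1)).Dom), ∀ φ ∈ sp k X,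
      ‖(G k).E ((t : ℝ) : ℂ) old φ X - (G k).E ((t' : ℝ) : ℂ) old φ X‖ ≤ Real.exp (-(κ * (domSys P M (k + 1)).dj X)) * (lam k * |t - t'|))
    (hlam : ∀ k, lam k ≤ ℓ₁) (hℓ₁ : 0 ≤ ℓ₁)
    (hG2last : ∀ (k : ℕ) (old : OlderTerms P 𝔸 M k), Adm k old → ∀ (t d : ℝ), 0 < d → t - d ∈ Ioc (0 : ℝ) γ → t + d ∈ Ioc (0 : ℝ) γ →
      ∀ (X : (domSys P M (k + 1)).Dom), ∀ φ ∈ sp k X,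
        ‖(G k).E ((t + d : ℝ) : ℂ) old φ X - 2 * (G k).E ((t : ℝ) : ℂ) old φ X + (G k).E ((t - d : ℝ) : ℂ) old φ X‖ ≤
          Real.exp (-(κ * (domSys P M (k + 1)).dj X)) * (lam₂ k * d ^ 2))
    (hlam₂ : ∀ k, lam₂ k ≤ ℓ₂) (hℓ₂ : 0 ≤ ℓ₂) (hν : ω₁ + 4 * Mb * cw / ϱ < ν) (hμν : (ω₁ + 4 * Mb * cw / ϱ) ^ 2 ≤ ν) (K : ℕ) :
    ∀ (k : ℕ) (i : Fin (k + 1)), ∀ g ∈ box γ k, ∀ (X : (domSys P M (k + 1)).Dom), ∀ φ ∈ sp k X, ∀ t d : ℝ, 0 < d →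
      t - d ∈ Ioc (0 : ℝ) γ → t + d ∈ Ioc (0 : ℝ) γ →
        ‖(truncRun K (toClusterTower G) k).E (Function.update g i (t + d)) φ X - 2 * (truncRun K (toClusterTower G) k).E (Function.update g i t) φ X +
            (truncRun K (toClusterTower G) k).E (Function.update g i (t - d)) φ X‖ ≤
          max ℓ₂ (64 * Mb * cw ^ 2 / ϱ ^ 2 * ℓ₁ ^ 2 / (ν - ω₁ - 4 * Mb * cw / ϱ)) * ν ^ (k - (i : ℕ)) * Real.exp (-(κ * (domSys P M (k + 1)).dj X)) * d ^ 2 := by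
  have hG1 := genT1_of_analyticReading G sp Adm ρ A hsp hϱ hR hGA hA hMb hAdmr hρ₁ hw hw0 hGt
  have hG2old := genT2old_of_analyticReading G sp Adm ρ A hsp hϱ hR hGA hA hMb hAdmr hρ₁ hρ₂ hw hw0
  have hc : 0 ≤ 4 * Mb * cw / ϱ := by positivity
  have hcb : 0 ≤ 64 * Mb * cw ^ 2 / ϱ ^ 2 := by positivity
  have ha : ∀ k j, j ≤ k → 0 ≤ 4 * Mb / ϱ * w k j ∧ 4 * Mb / ϱ * w k j ≤ 4 * Mb * cw / ϱ * ω₁ ^ (k - j) := fun k j hjk =>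
    ⟨mul_nonneg (by positivity) (hw k j),
      calc 4 * Mb / ϱ * w k j ≤ 4 * Mb / ϱ * (cw * ω₁ ^ (k - j)) := mul_le_mul_of_nonneg_left (hwω k j hjk) (by positivity)
        _ = 4 * Mb * cw / ϱ * ω₁ ^ (k - j) := by ring⟩
  have hb : ∀ k j, j ≤ k → 0 ≤ 64 * Mb / ϱ ^ 2 * w k j ^ 2 ∧ 64 * Mb / ϱ ^ 2 * w k j ^ 2 ≤ 64 * Mb * cw ^ 2 / ϱ ^ 2 * ω₁ ^ (k - j) := fun k j hjk =>
    ⟨mul_nonneg (by positivity) (sq_nonneg _), by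
      have h1 : w k j ^ 2 ≤ (cw * ω₁ ^ (k - j)) ^ 2 := pow_le_pow_left₀ (hw k j) (hwω k j hjk) 2
      have h2 : (ω₁ ^ (k - j)) ^ 2 ≤ ω₁ ^ (k - j) := by
        rw [sq]
        exact mul_le_of_le_one_left (pow_nonneg hω₁ _) (pow_le_one₀ hω₁ hω₁1)
      calc 64 * Mb / ϱ ^ 2 * w k j ^ 2 ≤ 64 * Mb / ϱ ^ 2 * (cw * ω₁ ^ (k - j)) ^ 2 := mul_le_mul_of_nonneg_left h1 (by positivity)
        _ = 64 * Mb * cw ^ 2 / ϱ ^ 2 * (ω₁ ^ (k - j)) ^ 2 := by ring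
        _ ≤ 64 * Mb * cw ^ 2 / ϱ ^ 2 * ω₁ ^ (k - j) := mul_le_mul_of_nonneg_left h2 hcb⟩
  exact termSecondDiffAt_box_truncRun_toClusterTower_of_genStepRecursion G sp Adm hsp hγ hAdm hG1 hlam hℓ₁ hG2last hG2old ha hb hlam₂ hℓ₂ hc hcb hω₁ hν hμν K

end Gen

end YMDAG.N22.TermRecursion

namespace YMDAG.N22.KernelFading

open Literature.MathematicalPhysics.QuantumFieldTheory.Balaban1983to89
open Literature.MathematicalPhysics.QuantumFieldTheory.Balaban1983to89.T4Continuum (T4Family ULoop)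
open Literature.MathematicalPhysics.QuantumFieldTheory.Balaban1983to89.T4OutputRate (Window NE9)
open Literature.MathematicalPhysics.QuantumFieldTheory.Balaban1983to89.TreeLengthTorus (TPt)
open Literature.MathematicalPhysics.QuantumFieldTheory.Balaban1983to89.B12TreeDecay (K₀ kappa₀)
open Literature.MathematicalPhysics.QuantumFieldTheory.Balaban1983to89.B12Decay510 (delta1)
open Literature.MathematicalPhysics.QuantumFieldTheory.Balaban1983to89.B12Decay510Window (K₁)
open Literature.MathematicalPhysics.QuantumFieldTheory.Balaban1983to89.B12Decay510Torus (distCT nearT)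
open Literature.MathematicalPhysics.QuantumFieldTheory.Balaban1983to89.Node00 (Stage13Params Stage13HParams U3Letters₁₁ MatA)
open Literature.MathematicalPhysics.QuantumFieldTheory.Balaban1983to89.Node00.Sect2 (domSys domCount CPair)
open Literature.MathematicalPhysics.QuantumFieldTheory.Balaban1983to89.Node00.W1
open Literature.MathematicalPhysics.QuantumFieldTheory.Balaban1983to89.Node00.LocalizedSum17 (ReadingMaps Localizes17OfRecord₁₃)
open Literature.MathematicalPhysics.QuantumFieldTheory.Balaban1983to89.Node00.U3OfKernels (histPrefix objectsOfRecord₁₃)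
open Literature.MathematicalPhysics.QuantumFieldTheory.Balaban1983to89.Node00.U3KernelLetters (KernelStepRateOfRecord₁₃ PolLimitsExistOfRecord₁₃)
open YMDAG.UVSplit (N22At u3OfRecord₁₃ RateReading₁₃CoPH rateCarriersOfRecord₁₃CoPH)
open YMDAG.N22.AtKernels (n22At_rateCarriers_of_kernels_pin_of_ne9 n22At_u3OfRecord₁₃_objectsOfRecord₁₃_iff)
open YMDAG.N22.TermRecursion (genT1_of_analyticReading genT2old_of_analyticReading)

open scoped Matrix.Norms.L2Operator

variable (F : T4Family) (N : ℕ) [NeZero N] {𝔸 : Type} {M : ℕ}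

/-! ## §1 ★★★ K3's `h9` on ROAD 2 from node N18's kernel step rate + the analytic reading + the last-coupling schemas + the output bound -/

open Classical Finset in
/-- ★★★ **K3's `h9` ON ROAD 2 FROM NODE N18's KERNEL STEP RATE + THE ANALYTIC READING OF node00-def-W1's ONE-STEP MAP + THE LAST-COUPLING SCHEMAS, AT THE RUN TOWERS OF RECORD —
NO second-order older-term schema, NO smallness of the recursion's growth.**  At a Stage-13 tuple `θ` (`0 < θ.γ`) with a letter block `ℓ` (`ℓ.Signs`): (N18)
`KernelStepRateOfRecord₁₃ F N θ κ₅ ℓ.θ₅ C₅`; generator towers `Gn K` whose run towers `truncRun K (toClusterTower (Gn K))` meet W1-20's law through `emb`, with (1.21); per torus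
and step the ANALYTIC READING (module J57: (AR-fact) `((Gn K) k).E t old φ X = A K k t φ X (ρA K k old)` on `Adm K k`, (AR-holo) `A` holomorphic with `‖A‖ ≤ M_b·e^{−κ_E d}` on
`ball 0 R`, (AR-adm) `‖ρA K k old‖ ≤ r₀`, `r₀ + ϱ < R`, (AR-dom₁∕₂) sup-type reading dominations with age weights `0 ≤ aw K k j ≤ c_w·ω₁^{k−j}`, `aw K k 0 = 0`, `ω₁ ≤ 1`), the
LAST-coupling schemas (G-T1-last) (`lam ≤ ℓ₁`) and (G-T2-last) (`lam₂ ≤ ℓ₂`), (Adm-run); rows `ω₁ + c < ν`, `(ω₁ + c)² ≤ ν`, `1 ≤ ν` at **`c = 4M_b c_w∕ϱ`**; the output bound `hbd`,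
term holomorphy `hEhol`, chart, space clause, site weights and tails at the run towers; `2κ₀(64,8) ≤ κ ≤ κ_E`; the letter rows with `ℓ.θ₅·ν ≤ ℓ.ω²` and the `C₉` row at
`L₂ = max ℓ₂ (c_b ℓ₁²∕(ν − ω₁ − c))`, **`c_b = 64M_b c_w²∕ϱ²`** ⟹ **`NE9 ((objectsOfRecord₁₃ F N θ ℓ).EA 0) (Window θ.γ) ℓ.κ ℓ.moduli`** — J57's `genT1_of_analyticReading` ∕
`genT2old_of_analyticReading` at every torus supply module J54 §1's `hG1` ∕ `hG2old` with channels `a = (4M_b∕ϱ)·aw`, `b = (64M_b∕ϱ²)·aw²`.  LOCATED (hypothesis form: (AR) is the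
cell's reading of [II] (2.14)–(2.15) p. 15 for the older terms as independent variables — GAPS G-ne9p2-5 — on def-W1's generator; the last-coupling schemas are [I] (1.17)-type);
N22 NOT discharged. [folklore] -/
theorem ne9_EA_objectsOfRecord₁₃_of_kernelStepRate_genAnalyticReading (θ : Stage13Params F N) (ℓ : U3Letters₁₁) (hs : ℓ.Signs) (hγ : 0 < θ.γ)
    (hlim : PolLimitsExistOfRecord₁₃ F N θ) {κ₅ C₅ : ℝ} (hC₅ : 0 ≤ C₅) (h5 : KernelStepRateOfRecord₁₃ F N θ κ₅ ℓ.θ₅ C₅)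
    (m' : ℕ) (M : ℕ) [NeZero M] (hM : M = F.L ^ m')
    (Gn : (K : ℕ) → GenTower (F.P K) 𝔸 M) (emb : ReadingMaps F (MatA N) 𝔸)
    (hloc : Localizes17OfRecord₁₃ F N θ (fun K => truncRun K (toClusterTower (Gn K))) emb)
    (sp : (K k : ℕ) → (domSys (F.P K) M (k + 1)).Dom → Set (CPair (F.P K) 𝔸))
    {κ κE δ₀ B₃ r B ℓ₁ ℓ₂ R r₀ ϱ Mb cw ω₁ ν : ℝ} {lam lam₂ : ℕ → ℕ → ℝ} {aw : ℕ → ℕ → ℕ → ℝ}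
    (hκ₀ : kappa₀ (4 * 2 ^ 4) (2 * 4) ≤ κ / 2) (hδ₀ : 0 < δ₀) (hB₃ : 0 ≤ B₃) (hr : 0 < r) (hB : 0 ≤ B) (hκE : κ ≤ κE)
    (Adm : (K k : ℕ) → OlderTerms (F.P K) 𝔸 M k → Prop)
    (hAdm : ∀ K, ∀ g ∈ Window θ.γ, ∀ k, Adm K k (olderOf (recTerm (Gn K) fun n => ((g n : ℝ) : ℂ)) k))
    {Pot : ℕ → ℕ → Type*} [∀ K k, NormedAddCommGroup (Pot K k)] [∀ K k, NormedSpace ℂ (Pot K k)]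
    (ρA : (K k : ℕ) → OlderTerms (F.P K) 𝔸 M k → Pot K k) (A : (K k : ℕ) → ℝ → CPair (F.P K) 𝔸 → (domSys (F.P K) M (k + 1)).Dom → Pot K k → ℂ)
    (hGA : ∀ (K k : ℕ), ∀ t ∈ Ioc (0 : ℝ) θ.γ, ∀ (old : OlderTerms (F.P K) 𝔸 M k), Adm K k old → ∀ (X : (domSys (F.P K) M (k + 1)).Dom), ∀ φ ∈ sp K k X,
      ((Gn K) k).E ((t : ℝ) : ℂ) old φ X = A K k t φ X (ρA K k old))
    (hA : ∀ (K k : ℕ), ∀ t ∈ Ioc (0 : ℝ) θ.γ, ∀ (X : (domSys (F.P K) M (k + 1)).Dom), ∀ φ ∈ sp K k X, DifferentiableOn ℂ (A K k t φ X) (ball 0 R))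
    (hMbA : ∀ (K k : ℕ), ∀ t ∈ Ioc (0 : ℝ) θ.γ, ∀ (X : (domSys (F.P K) M (k + 1)).Dom), ∀ φ ∈ sp K k X, ∀ p ∈ ball (0 : Pot K k) R,
      ‖A K k t φ X p‖ ≤ Mb * Real.exp (-(κE * (domSys (F.P K) M (k + 1)).dj X)))
    (hAdmr : ∀ (K k : ℕ) (old : OlderTerms (F.P K) 𝔸 M k), Adm K k old → ‖ρA K k old‖ ≤ r₀)
    (hρ₁ : ∀ (K k : ℕ) (o o' : OlderTerms (F.P K) 𝔸 M k), Adm K k o → Adm K k o' → ∀ (B' : ℝ), 0 ≤ B' →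
      (∀ (k' : ℕ) (hk' : k' < k) (Y : (domSys (F.P K) M (k' + 1)).Dom), ∀ φ' ∈ sp K k' Y,
        aw K k (k' + 1) * (Real.exp (κE * (domSys (F.P K) M (k' + 1)).dj Y) * ‖o ⟨k' + 1, Nat.succ_lt_succ hk'⟩ Y φ' - o' ⟨k' + 1, Nat.succ_lt_succ hk'⟩ Y φ'‖) ≤ B') →
      ‖ρA K k o - ρA K k o'‖ ≤ B')
    (hρ₂ : ∀ (K k : ℕ) (o₁ o₂ o₃ : OlderTerms (F.P K) 𝔸 M k), Adm K k o₁ → Adm K k o₂ → Adm K k o₃ → ∀ (B' : ℝ), 0 ≤ B' →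
      (∀ (k' : ℕ) (hk' : k' < k) (Y : (domSys (F.P K) M (k' + 1)).Dom), ∀ φ' ∈ sp K k' Y,
        aw K k (k' + 1) * (Real.exp (κE * (domSys (F.P K) M (k' + 1)).dj Y) *
          ‖o₁ ⟨k' + 1, Nat.succ_lt_succ hk'⟩ Y φ' - 2 * o₂ ⟨k' + 1, Nat.succ_lt_succ hk'⟩ Y φ' + o₃ ⟨k' + 1, Nat.succ_lt_succ hk'⟩ Y φ'‖) ≤ B') →
      ‖ρA K k o₁ - (2 : ℂ) • ρA K k o₂ + ρA K k o₃‖ ≤ B')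
    (haw : ∀ K k j, 0 ≤ aw K k j) (haw0 : ∀ K k, aw K k 0 = 0) (hawω : ∀ K k j, j ≤ k → aw K k j ≤ cw * ω₁ ^ (k - j)) (hcw : 0 ≤ cw)
    (hMb0 : 0 ≤ Mb) (hϱ : 0 < ϱ) (hR : r₀ + ϱ < R)
    (hGt : ∀ (K k : ℕ), ∀ t ∈ Ioc (0 : ℝ) θ.γ, ∀ t' ∈ Ioc (0 : ℝ) θ.γ, ∀ (old : OlderTerms (F.P K) 𝔸 M k), Adm K k old → ∀ (X : (domSys (F.P K) M (k + 1)).Dom), ∀ φ ∈ sp K k X,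
      ‖((Gn K) k).E ((t : ℝ) : ℂ) old φ X - ((Gn K) k).E ((t' : ℝ) : ℂ) old φ X‖ ≤ Real.exp (-(κE * (domSys (F.P K) M (k + 1)).dj X)) * (lam K k * |t - t'|))
    (hlam : ∀ K k, lam K k ≤ ℓ₁) (hℓ₁ : 0 ≤ ℓ₁)
    (hG2last : ∀ (K k : ℕ) (old : OlderTerms (F.P K) 𝔸 M k), Adm K k old → ∀ (t d : ℝ), 0 < d → t - d ∈ Ioc (0 : ℝ) θ.γ → t + d ∈ Ioc (0 : ℝ) θ.γ →
      ∀ (X : (domSys (F.P K) M (k + 1)).Dom), ∀ φ ∈ sp K k X,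
        ‖((Gn K) k).E ((t + d : ℝ) : ℂ) old φ X - 2 * ((Gn K) k).E ((t : ℝ) : ℂ) old φ X + ((Gn K) k).E ((t - d : ℝ) : ℂ) old φ X‖ ≤
          Real.exp (-(κE * (domSys (F.P K) M (k + 1)).dj X)) * (lam₂ K k * d ^ 2))
    (hlam₂ : ∀ K k, lam₂ K k ≤ ℓ₂) (hℓ₂ : 0 ≤ ℓ₂) (hω₁ : 0 ≤ ω₁) (hω₁1 : ω₁ ≤ 1) (hν : ω₁ + 4 * Mb * cw / ϱ < ν)
    (hμν : (ω₁ + 4 * Mb * cw / ϱ) ^ 2 ≤ ν) (hν1 : 1 ≤ ν)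
    (hbd : ∀ g ∈ Window θ.γ, ∀ (K k : ℕ) (X : (domSys (F.P K) M (k + 1)).Dom), ∀ φ ∈ sp K k X,
      ‖(truncRun K (toClusterTower (Gn K)) k).E (histPrefix g k) φ X‖ ≤ B * Real.exp (-(κE * (domSys (F.P K) M (k + 1)).dj X)))
    (Ec : ℕ → ℕ → Type*) [∀ K k, NormedAddCommGroup (Ec K k)] [∀ K k, NormedSpace ℂ (Ec K k)]
    (ι : letI := θ.instVβ₁; letI := θ.instVβ₂
      (K k : ℕ) → (domSys (F.P K) M (k + 1)).Dom → ((Fin (F.P K).d → Site (F.P K) (k + 1) → θ.Vβ) →L[ℝ] Ec K k))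
    (Φ : (K k : ℕ) → (domSys (F.P K) M (k + 1)).Dom → Ec K k → CPair (F.P K) 𝔸)
    (U : (K k : ℕ) → (domSys (F.P K) M (k + 1)).Dom → Set (Ec K k)) (hU : ∀ K k X, IsOpen (U K k X)) (hrU : ∀ K k X, ball (0 : Ec K k) r ⊆ U K k X)
    (hEhol : ∀ g ∈ Window θ.γ, ∀ (K k : ℕ) (X : (domSys (F.P K) M (k + 1)).Dom),
      DifferentiableOn ℂ (fun z => (truncRun K (toClusterTower (Gn K)) k).E (histPrefix g k) (Φ K k X z) X) (U K k X))
    (hΦemb : letI := θ.instVβ₁; letI := θ.instVβ₂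
      ∀ (K k : ℕ) (X : (domSys (F.P K) M (k + 1)).Dom) (Bf : Fin (F.P K).d → Site (F.P K) (k + 1) → θ.Vβ),
        Φ K k X (ι K k X Bf) = emb K k (fun l t => NormedSpace.exp (θ.ρ8 (Bf l t))))
    (hΦsp : ∀ (K k : ℕ) (X : (domSys (F.P K) M (k + 1)).Dom), ∀ z ∈ ball (0 : Ec K k) r, Φ K k X z ∈ sp K k X)
    (w : (K k : ℕ) → (domSys (F.P K) M (k + 1)).Dom → Site (F.P K) (k + 1) → ℝ) (hw₀ : ∀ K k X t, 0 ≤ w K k X t)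
    (hw : letI := θ.instVβ₁; letI := θ.instVβ₂; letI := θ.instιβ
      ∀ (K k : ℕ) (X : (domSys (F.P K) M (k + 1)).Dom) (l : Fin (F.P K).d) (t : Site (F.P K) (k + 1)) (c : θ.ιβ),
        ‖ι K k X (Pi.single l (Pi.single t (θ.bV c)))‖ ≤ w K k X t)
    (htail : ∀ (K k : ℕ) (X : (domSys (F.P K) M (k + 1)).Dom) (t : Site (F.P K) (k + 1)),
      let e : Site (F.P K) (k + 1) → TPt 4 (domCount (F.P K) M (k + 1) * M) := fun x i => (ZMod.cast (x i) : ZMod (domCount (F.P K) M (k + 1) * M))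
      w K k X t ≤ B₃ * Real.exp (-δ₀ * distCT (domCount (F.P K) M (k + 1)) M (e t) (nearT (M := M) (e t) X)))
    (hκ₅ : delta1 δ₀ κ ((M : ℝ) * 4) ≤ κ₅)
    (hω : 0 < ℓ.ω) (hθω : ℓ.θ₅ * ν ≤ ℓ.ω ^ 2) (hℓκ : ℓ.κ ≤ delta1 δ₀ κ ((M : ℝ) * 4))
    (hC₉ : (4 * (2 * C₅ / (1 - ℓ.θ₅) + 2 * ((16 * B * B₃ ^ 2 / r ^ 2) * Real.exp (delta1 δ₀ κ ((M : ℝ) * 4) * ((M : ℝ) * 4) * 3) * K₀ (4 * 2 ^ 4) (2 * 4) * K₁ 4 (δ₀ / 2))) / θ.γ +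
        ((16 * max ℓ₂ (64 * Mb * cw ^ 2 / ϱ ^ 2 * ℓ₁ ^ 2 / (ν - ω₁ - 4 * Mb * cw / ϱ)) * B₃ ^ 2 / r ^ 2) * Real.exp (delta1 δ₀ κ ((M : ℝ) * 4) * ((M : ℝ) * 4) * 3) * K₀ (4 * 2 ^ 4) (2 * 4) *
          K₁ 4 (δ₀ / 2)) * θ.γ / 2) / ℓ.ω ≤ ℓ.C₉) :
    NE9 ((objectsOfRecord₁₃ F N θ ℓ).EA 0) (Window θ.γ) ℓ.κ ℓ.moduli := by
  -- tables non-empty through the chart at `z = 0`; module J57 at every torus: the schemas (G-T1), (G-T2-old) from the analytic reading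
  have hsp : ∀ (K k : ℕ) (X : (domSys (F.P K) M (k + 1)).Dom), (sp K k X).Nonempty := fun K k X => ⟨Φ K k X 0, hΦsp K k X 0 (mem_ball_self hr)⟩
  have hG1 := fun K => genT1_of_analyticReading (Gn K) (sp K) (Adm K) (ρA K) (A K) (hsp K) hϱ hR (hGA K) (hA K) (hMbA K) (hAdmr K) (hρ₁ K) (haw K) (haw0 K) (hGt K)
  have hG2old := fun K => genT2old_of_analyticReading (Gn K) (sp K) (Adm K) (ρA K) (A K) (hsp K) hϱ hR (hGA K) (hA K) (hMbA K) (hAdmr K) (hρ₁ K) (hρ₂ K) (haw K) (haw0 K)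
  -- the channels meet J54's rows at `c = 4M_b c_w∕ϱ`, `c_b = 64M_b c_w²∕ϱ²`
  have hc : 0 ≤ 4 * Mb * cw / ϱ := by positivity
  have hcb : 0 ≤ 64 * Mb * cw ^ 2 / ϱ ^ 2 := by positivity
  have ha : ∀ K k j, j ≤ k → 0 ≤ 4 * Mb / ϱ * aw K k j ∧ 4 * Mb / ϱ * aw K k j ≤ 4 * Mb * cw / ϱ * ω₁ ^ (k - j) := fun K k j hjk =>
    ⟨mul_nonneg (by positivity) (haw K k j),
      calc 4 * Mb / ϱ * aw K k j ≤ 4 * Mb / ϱ * (cw * ω₁ ^ (k - j)) := mul_le_mul_of_nonneg_left (hawω K k j hjk) (by positivity)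
        _ = 4 * Mb * cw / ϱ * ω₁ ^ (k - j) := by ring⟩
  have hb : ∀ K k j, j ≤ k → 0 ≤ 64 * Mb / ϱ ^ 2 * aw K k j ^ 2 ∧ 64 * Mb / ϱ ^ 2 * aw K k j ^ 2 ≤ 64 * Mb * cw ^ 2 / ϱ ^ 2 * ω₁ ^ (k - j) :=
    fun K k j hjk => ⟨mul_nonneg (by positivity) (sq_nonneg _), by
      have h1 : aw K k j ^ 2 ≤ (cw * ω₁ ^ (k - j)) ^ 2 := pow_le_pow_left₀ (haw K k j) (hawω K k j hjk) 2
      have h2 : (ω₁ ^ (k - j)) ^ 2 ≤ ω₁ ^ (k - j) := by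
        rw [sq]
        exact mul_le_of_le_one_left (pow_nonneg hω₁ _) (pow_le_one₀ hω₁ hω₁1)
      calc 64 * Mb / ϱ ^ 2 * aw K k j ^ 2 ≤ 64 * Mb / ϱ ^ 2 * (cw * ω₁ ^ (k - j)) ^ 2 := mul_le_mul_of_nonneg_left h1 (by positivity)
        _ = 64 * Mb * cw ^ 2 / ϱ ^ 2 * (ω₁ ^ (k - j)) ^ 2 := by ring
        _ ≤ 64 * Mb * cw ^ 2 / ϱ ^ 2 * ω₁ ^ (k - j) := mul_le_mul_of_nonneg_left h2 hcb⟩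
  exact ne9_EA_objectsOfRecord₁₃_of_kernelStepRate_genStepRecursion F N θ ℓ hs hγ hlim hC₅ h5 m' M hM Gn emb hloc sp hκ₀ hδ₀ hB₃ hr hB hκE Adm hAdm hG1 hlam hℓ₁ hG2last
    hG2old ha hb hlam₂ hℓ₂ hc hcb hω₁ hν hμν hν1 hbd Ec ι Φ U hU hrU hEhol hΦemb hΦsp w hw₀ hw htail hκ₅ hω hθω hℓκ hC₉

/-! ## §2 ★★★ The kernel-face socket on ROAD 2 from the analytic reading -/

open Classical Finset in
/-- ★★★ **THE KERNEL-FACE SOCKET ON ROAD 2 FROM THE ANALYTIC READING** — §1's inputs ⟹ **`N22At (u3OfRecord₁₃ θ (objectsOfRecord₁₃ F N θ ℓ) k)` for EVERY run length `k`**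
(dag-n27-c's `h22` row of the `…KernelFaces` leaves), by dag-n22-w3's level-free `n22At_u3OfRecord₁₃_objectsOfRecord₁₃_iff` on §1.  LOCATED (hypothesis form); N22 NOT
discharged. [folklore] -/
theorem n22At_u3OfRecord₁₃_of_kernelStepRate_genAnalyticReading (θ : Stage13Params F N) (ℓ : U3Letters₁₁) (hs : ℓ.Signs) (hγ : 0 < θ.γ)
    (hlim : PolLimitsExistOfRecord₁₃ F N θ) {κ₅ C₅ : ℝ} (hC₅ : 0 ≤ C₅) (h5 : KernelStepRateOfRecord₁₃ F N θ κ₅ ℓ.θ₅ C₅)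
    (m' : ℕ) (M : ℕ) [NeZero M] (hM : M = F.L ^ m')
    (Gn : (K : ℕ) → GenTower (F.P K) 𝔸 M) (emb : ReadingMaps F (MatA N) 𝔸)
    (hloc : Localizes17OfRecord₁₃ F N θ (fun K => truncRun K (toClusterTower (Gn K))) emb)
    (sp : (K k : ℕ) → (domSys (F.P K) M (k + 1)).Dom → Set (CPair (F.P K) 𝔸))
    {κ κE δ₀ B₃ r B ℓ₁ ℓ₂ R r₀ ϱ Mb cw ω₁ ν : ℝ} {lam lam₂ : ℕ → ℕ → ℝ} {aw : ℕ → ℕ → ℕ → ℝ}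
    (hκ₀ : kappa₀ (4 * 2 ^ 4) (2 * 4) ≤ κ / 2) (hδ₀ : 0 < δ₀) (hB₃ : 0 ≤ B₃) (hr : 0 < r) (hB : 0 ≤ B) (hκE : κ ≤ κE)
    (Adm : (K k : ℕ) → OlderTerms (F.P K) 𝔸 M k → Prop)
    (hAdm : ∀ K, ∀ g ∈ Window θ.γ, ∀ k, Adm K k (olderOf (recTerm (Gn K) fun n => ((g n : ℝ) : ℂ)) k))
    {Pot : ℕ → ℕ → Type*} [∀ K k, NormedAddCommGroup (Pot K k)] [∀ K k, NormedSpace ℂ (Pot K k)]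
    (ρA : (K k : ℕ) → OlderTerms (F.P K) 𝔸 M k → Pot K k) (A : (K k : ℕ) → ℝ → CPair (F.P K) 𝔸 → (domSys (F.P K) M (k + 1)).Dom → Pot K k → ℂ)
    (hGA : ∀ (K k : ℕ), ∀ t ∈ Ioc (0 : ℝ) θ.γ, ∀ (old : OlderTerms (F.P K) 𝔸 M k), Adm K k old → ∀ (X : (domSys (F.P K) M (k + 1)).Dom), ∀ φ ∈ sp K k X,
      ((Gn K) k).E ((t : ℝ) : ℂ) old φ X = A K k t φ X (ρA K k old))
    (hA : ∀ (K k : ℕ), ∀ t ∈ Ioc (0 : ℝ) θ.γ, ∀ (X : (domSys (F.P K) M (k + 1)).Dom), ∀ φ ∈ sp K k X, DifferentiableOn ℂ (A K k t φ X) (ball 0 R))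
    (hMbA : ∀ (K k : ℕ), ∀ t ∈ Ioc (0 : ℝ) θ.γ, ∀ (X : (domSys (F.P K) M (k + 1)).Dom), ∀ φ ∈ sp K k X, ∀ p ∈ ball (0 : Pot K k) R,
      ‖A K k t φ X p‖ ≤ Mb * Real.exp (-(κE * (domSys (F.P K) M (k + 1)).dj X)))
    (hAdmr : ∀ (K k : ℕ) (old : OlderTerms (F.P K) 𝔸 M k), Adm K k old → ‖ρA K k old‖ ≤ r₀)
    (hρ₁ : ∀ (K k : ℕ) (o o' : OlderTerms (F.P K) 𝔸 M k), Adm K k o → Adm K k o' → ∀ (B' : ℝ), 0 ≤ B' →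
      (∀ (k' : ℕ) (hk' : k' < k) (Y : (domSys (F.P K) M (k' + 1)).Dom), ∀ φ' ∈ sp K k' Y,
        aw K k (k' + 1) * (Real.exp (κE * (domSys (F.P K) M (k' + 1)).dj Y) * ‖o ⟨k' + 1, Nat.succ_lt_succ hk'⟩ Y φ' - o' ⟨k' + 1, Nat.succ_lt_succ hk'⟩ Y φ'‖) ≤ B') →
      ‖ρA K k o - ρA K k o'‖ ≤ B')
    (hρ₂ : ∀ (K k : ℕ) (o₁ o₂ o₃ : OlderTerms (F.P K) 𝔸 M k), Adm K k o₁ → Adm K k o₂ → Adm K k o₃ → ∀ (B' : ℝ), 0 ≤ B' →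
      (∀ (k' : ℕ) (hk' : k' < k) (Y : (domSys (F.P K) M (k' + 1)).Dom), ∀ φ' ∈ sp K k' Y,
        aw K k (k' + 1) * (Real.exp (κE * (domSys (F.P K) M (k' + 1)).dj Y) *
          ‖o₁ ⟨k' + 1, Nat.succ_lt_succ hk'⟩ Y φ' - 2 * o₂ ⟨k' + 1, Nat.succ_lt_succ hk'⟩ Y φ' + o₃ ⟨k' + 1, Nat.succ_lt_succ hk'⟩ Y φ'‖) ≤ B') →
      ‖ρA K k o₁ - (2 : ℂ) • ρA K k o₂ + ρA K k o₃‖ ≤ B')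
    (haw : ∀ K k j, 0 ≤ aw K k j) (haw0 : ∀ K k, aw K k 0 = 0) (hawω : ∀ K k j, j ≤ k → aw K k j ≤ cw * ω₁ ^ (k - j)) (hcw : 0 ≤ cw)
    (hMb0 : 0 ≤ Mb) (hϱ : 0 < ϱ) (hR : r₀ + ϱ < R)
    (hGt : ∀ (K k : ℕ), ∀ t ∈ Ioc (0 : ℝ) θ.γ, ∀ t' ∈ Ioc (0 : ℝ) θ.γ, ∀ (old : OlderTerms (F.P K) 𝔸 M k), Adm K k old → ∀ (X : (domSys (F.P K) M (k + 1)).Dom), ∀ φ ∈ sp K k X,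
      ‖((Gn K) k).E ((t : ℝ) : ℂ) old φ X - ((Gn K) k).E ((t' : ℝ) : ℂ) old φ X‖ ≤ Real.exp (-(κE * (domSys (F.P K) M (k + 1)).dj X)) * (lam K k * |t - t'|))
    (hlam : ∀ K k, lam K k ≤ ℓ₁) (hℓ₁ : 0 ≤ ℓ₁)
    (hG2last : ∀ (K k : ℕ) (old : OlderTerms (F.P K) 𝔸 M k), Adm K k old → ∀ (t d : ℝ), 0 < d → t - d ∈ Ioc (0 : ℝ) θ.γ → t + d ∈ Ioc (0 : ℝ) θ.γ →
      ∀ (X : (domSys (F.P K) M (k + 1)).Dom), ∀ φ ∈ sp K k X,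
        ‖((Gn K) k).E ((t + d : ℝ) : ℂ) old φ X - 2 * ((Gn K) k).E ((t : ℝ) : ℂ) old φ X + ((Gn K) k).E ((t - d : ℝ) : ℂ) old φ X‖ ≤
          Real.exp (-(κE * (domSys (F.P K) M (k + 1)).dj X)) * (lam₂ K k * d ^ 2))
    (hlam₂ : ∀ K k, lam₂ K k ≤ ℓ₂) (hℓ₂ : 0 ≤ ℓ₂) (hω₁ : 0 ≤ ω₁) (hω₁1 : ω₁ ≤ 1) (hν : ω₁ + 4 * Mb * cw / ϱ < ν)
    (hμν : (ω₁ + 4 * Mb * cw / ϱ) ^ 2 ≤ ν) (hν1 : 1 ≤ ν)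
    (hbd : ∀ g ∈ Window θ.γ, ∀ (K k : ℕ) (X : (domSys (F.P K) M (k + 1)).Dom), ∀ φ ∈ sp K k X,
      ‖(truncRun K (toClusterTower (Gn K)) k).E (histPrefix g k) φ X‖ ≤ B * Real.exp (-(κE * (domSys (F.P K) M (k + 1)).dj X)))
    (Ec : ℕ → ℕ → Type*) [∀ K k, NormedAddCommGroup (Ec K k)] [∀ K k, NormedSpace ℂ (Ec K k)]
    (ι : letI := θ.instVβ₁; letI := θ.instVβ₂
      (K k : ℕ) → (domSys (F.P K) M (k + 1)).Dom → ((Fin (F.P K).d → Site (F.P K) (k + 1) → θ.Vβ) →L[ℝ] Ec K k))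
    (Φ : (K k : ℕ) → (domSys (F.P K) M (k + 1)).Dom → Ec K k → CPair (F.P K) 𝔸)
    (U : (K k : ℕ) → (domSys (F.P K) M (k + 1)).Dom → Set (Ec K k)) (hU : ∀ K k X, IsOpen (U K k X)) (hrU : ∀ K k X, ball (0 : Ec K k) r ⊆ U K k X)
    (hEhol : ∀ g ∈ Window θ.γ, ∀ (K k : ℕ) (X : (domSys (F.P K) M (k + 1)).Dom),
      DifferentiableOn ℂ (fun z => (truncRun K (toClusterTower (Gn K)) k).E (histPrefix g k) (Φ K k X z) X) (U K k X))
    (hΦemb : letI := θ.instVβ₁; letI := θ.instVβ₂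
      ∀ (K k : ℕ) (X : (domSys (F.P K) M (k + 1)).Dom) (Bf : Fin (F.P K).d → Site (F.P K) (k + 1) → θ.Vβ),
        Φ K k X (ι K k X Bf) = emb K k (fun l t => NormedSpace.exp (θ.ρ8 (Bf l t))))
    (hΦsp : ∀ (K k : ℕ) (X : (domSys (F.P K) M (k + 1)).Dom), ∀ z ∈ ball (0 : Ec K k) r, Φ K k X z ∈ sp K k X)
    (w : (K k : ℕ) → (domSys (F.P K) M (k + 1)).Dom → Site (F.P K) (k + 1) → ℝ) (hw₀ : ∀ K k X t, 0 ≤ w K k X t)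
    (hw : letI := θ.instVβ₁; letI := θ.instVβ₂; letI := θ.instιβ
      ∀ (K k : ℕ) (X : (domSys (F.P K) M (k + 1)).Dom) (l : Fin (F.P K).d) (t : Site (F.P K) (k + 1)) (c : θ.ιβ),
        ‖ι K k X (Pi.single l (Pi.single t (θ.bV c)))‖ ≤ w K k X t)
    (htail : ∀ (K k : ℕ) (X : (domSys (F.P K) M (k + 1)).Dom) (t : Site (F.P K) (k + 1)),
      let e : Site (F.P K) (k + 1) → TPt 4 (domCount (F.P K) M (k + 1) * M) := fun x i => (ZMod.cast (x i) : ZMod (domCount (F.P K) M (k + 1) * M))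
      w K k X t ≤ B₃ * Real.exp (-δ₀ * distCT (domCount (F.P K) M (k + 1)) M (e t) (nearT (M := M) (e t) X)))
    (hκ₅ : delta1 δ₀ κ ((M : ℝ) * 4) ≤ κ₅)
    (hω : 0 < ℓ.ω) (hθω : ℓ.θ₅ * ν ≤ ℓ.ω ^ 2) (hℓκ : ℓ.κ ≤ delta1 δ₀ κ ((M : ℝ) * 4))
    (hC₉ : (4 * (2 * C₅ / (1 - ℓ.θ₅) + 2 * ((16 * B * B₃ ^ 2 / r ^ 2) * Real.exp (delta1 δ₀ κ ((M : ℝ) * 4) * ((M : ℝ) * 4) * 3) * K₀ (4 * 2 ^ 4) (2 * 4) * K₁ 4 (δ₀ / 2))) / θ.γ +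
        ((16 * max ℓ₂ (64 * Mb * cw ^ 2 / ϱ ^ 2 * ℓ₁ ^ 2 / (ν - ω₁ - 4 * Mb * cw / ϱ)) * B₃ ^ 2 / r ^ 2) * Real.exp (delta1 δ₀ κ ((M : ℝ) * 4) * ((M : ℝ) * 4) * 3) * K₀ (4 * 2 ^ 4) (2 * 4) *
          K₁ 4 (δ₀ / 2)) * θ.γ / 2) / ℓ.ω ≤ ℓ.C₉) (k : ℕ) :
    N22At (u3OfRecord₁₃ θ (objectsOfRecord₁₃ F N θ ℓ) k) :=
  (n22At_u3OfRecord₁₃_objectsOfRecord₁₃_iff F N θ ℓ hs k).2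
    (ne9_EA_objectsOfRecord₁₃_of_kernelStepRate_genAnalyticReading F N θ ℓ hs hγ hlim hC₅ h5 m' M hM Gn emb hloc sp hκ₀ hδ₀ hB₃ hr hB hκE Adm hAdm ρA A hGA hA hMbA
      hAdmr hρ₁ hρ₂ haw haw0 hawω hcw hMb0 hϱ hR hGt hlam hℓ₁ hG2last hlam₂ hℓ₂ hω₁ hω₁1 hν hμν hν1 hbd Ec ι Φ U hU hrU hEhol hΦemb hΦsp w hw₀ hw htail hκ₅ hω hθω hℓκ hC₉)

/-! ## §3 ★★★ The N22 pin face on ROAD 2 from the analytic reading -/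

open Classical Finset in
/-- ★★★ **THE N22 PIN FACE ON ROAD 2 FROM THE ANALYTIC READING**: under K3's node-U3 pin at the tuple (`hpin`), §1's inputs at `θ.toStage13Params` give
`N22At (rateCarriersOfRecord₁₃CoPH 𝔯 F θ hP g₀ os k).u3` for EVERY run length `k` — dag-n22-w3's pin form fed with §1.  THE N22 ROW SENTENCE in this currency: «node N18's
kernel step rate of record + ANALYTICITY WITH A MARGIN of def-W1's one-step map in the older terms read into a Banach space (sup-type reading, age weights `≤ c_w ω₁^{age}`) +
first∕second-order regularity in the LAST coupling + generated runs admissible + the printed-type output bound + term holomorphy through the readings + tails + W1-20's law at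
the run towers + (1.21) + letter rows with `ℓ.θ₅·ν ≤ ℓ.ω²`, `ν > ω₁ + 4M_b c_w∕ϱ`, `ν ≥ (ω₁ + 4M_b c_w∕ϱ)²` ⇒ §2b `h9` ∕ `N22At`».  LOCATED (hypothesis form); N22 NOT
discharged. [folklore] -/
theorem n22At_rateCarriers_of_kernels_pin_of_kernelStepRate_genAnalyticReading (𝔯 : RateReading₁₃CoPH N) (θ : Stage13HParams F N) (hP : θ.Provisos₁₃CoPH F N)
    (g₀ : ℕ → ℝ) (os : List (ULoop F)) (ℓ : U3Letters₁₁) (hs : ℓ.Signs) (hγ : 0 < θ.γ)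
    (hpin : (𝔯.lit F θ hP g₀ os).u3 = objectsOfRecord₁₃ F N θ.toStage13Params ℓ)
    (hlim : PolLimitsExistOfRecord₁₃ F N θ.toStage13Params) {κ₅ C₅ : ℝ} (hC₅ : 0 ≤ C₅) (h5 : KernelStepRateOfRecord₁₃ F N θ.toStage13Params κ₅ ℓ.θ₅ C₅)
    (m' : ℕ) (M : ℕ) [NeZero M] (hM : M = F.L ^ m')
    (Gn : (K : ℕ) → GenTower (F.P K) 𝔸 M) (emb : ReadingMaps F (MatA N) 𝔸) (hloc : Localizes17OfRecord₁₃ F N θ.toStage13Params (fun K => truncRun K (toClusterTower (Gn K))) emb)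
    (sp : (K k : ℕ) → (domSys (F.P K) M (k + 1)).Dom → Set (CPair (F.P K) 𝔸))
    {κ κE δ₀ B₃ r B ℓ₁ ℓ₂ R r₀ ϱ Mb cw ω₁ ν : ℝ} {lam lam₂ : ℕ → ℕ → ℝ} {aw : ℕ → ℕ → ℕ → ℝ}
    (hκ₀ : kappa₀ (4 * 2 ^ 4) (2 * 4) ≤ κ / 2) (hδ₀ : 0 < δ₀) (hB₃ : 0 ≤ B₃) (hr : 0 < r) (hB : 0 ≤ B) (hκE : κ ≤ κE)
    (Adm : (K k : ℕ) → OlderTerms (F.P K) 𝔸 M k → Prop)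
    (hAdm : ∀ K, ∀ g ∈ Window θ.γ, ∀ k, Adm K k (olderOf (recTerm (Gn K) fun n => ((g n : ℝ) : ℂ)) k))
    {Pot : ℕ → ℕ → Type*} [∀ K k, NormedAddCommGroup (Pot K k)] [∀ K k, NormedSpace ℂ (Pot K k)]
    (ρA : (K k : ℕ) → OlderTerms (F.P K) 𝔸 M k → Pot K k) (A : (K k : ℕ) → ℝ → CPair (F.P K) 𝔸 → (domSys (F.P K) M (k + 1)).Dom → Pot K k → ℂ)
    (hGA : ∀ (K k : ℕ), ∀ t ∈ Ioc (0 : ℝ) θ.γ, ∀ (old : OlderTerms (F.P K) 𝔸 M k), Adm K k old → ∀ (X : (domSys (F.P K) M (k + 1)).Dom), ∀ φ ∈ sp K k X,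
      ((Gn K) k).E ((t : ℝ) : ℂ) old φ X = A K k t φ X (ρA K k old))
    (hA : ∀ (K k : ℕ), ∀ t ∈ Ioc (0 : ℝ) θ.γ, ∀ (X : (domSys (F.P K) M (k + 1)).Dom), ∀ φ ∈ sp K k X, DifferentiableOn ℂ (A K k t φ X) (ball 0 R))
    (hMbA : ∀ (K k : ℕ), ∀ t ∈ Ioc (0 : ℝ) θ.γ, ∀ (X : (domSys (F.P K) M (k + 1)).Dom), ∀ φ ∈ sp K k X, ∀ p ∈ ball (0 : Pot K k) R,
      ‖A K k t φ X p‖ ≤ Mb * Real.exp (-(κE * (domSys (F.P K) M (k + 1)).dj X)))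
    (hAdmr : ∀ (K k : ℕ) (old : OlderTerms (F.P K) 𝔸 M k), Adm K k old → ‖ρA K k old‖ ≤ r₀)
    (hρ₁ : ∀ (K k : ℕ) (o o' : OlderTerms (F.P K) 𝔸 M k), Adm K k o → Adm K k o' → ∀ (B' : ℝ), 0 ≤ B' →
      (∀ (k' : ℕ) (hk' : k' < k) (Y : (domSys (F.P K) M (k' + 1)).Dom), ∀ φ' ∈ sp K k' Y,
        aw K k (k' + 1) * (Real.exp (κE * (domSys (F.P K) M (k' + 1)).dj Y) * ‖o ⟨k' + 1, Nat.succ_lt_succ hk'⟩ Y φ' - o' ⟨k' + 1, Nat.succ_lt_succ hk'⟩ Y φ'‖) ≤ B') →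
      ‖ρA K k o - ρA K k o'‖ ≤ B')
    (hρ₂ : ∀ (K k : ℕ) (o₁ o₂ o₃ : OlderTerms (F.P K) 𝔸 M k), Adm K k o₁ → Adm K k o₂ → Adm K k o₃ → ∀ (B' : ℝ), 0 ≤ B' →
      (∀ (k' : ℕ) (hk' : k' < k) (Y : (domSys (F.P K) M (k' + 1)).Dom), ∀ φ' ∈ sp K k' Y,
        aw K k (k' + 1) * (Real.exp (κE * (domSys (F.P K) M (k' + 1)).dj Y) *
          ‖o₁ ⟨k' + 1, Nat.succ_lt_succ hk'⟩ Y φ' - 2 * o₂ ⟨k' + 1, Nat.succ_lt_succ hk'⟩ Y φ' + o₃ ⟨k' + 1, Nat.succ_lt_succ hk'⟩ Y φ'‖) ≤ B') →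
      ‖ρA K k o₁ - (2 : ℂ) • ρA K k o₂ + ρA K k o₃‖ ≤ B')
    (haw : ∀ K k j, 0 ≤ aw K k j) (haw0 : ∀ K k, aw K k 0 = 0) (hawω : ∀ K k j, j ≤ k → aw K k j ≤ cw * ω₁ ^ (k - j)) (hcw : 0 ≤ cw)
    (hMb0 : 0 ≤ Mb) (hϱ : 0 < ϱ) (hR : r₀ + ϱ < R)
    (hGt : ∀ (K k : ℕ), ∀ t ∈ Ioc (0 : ℝ) θ.γ, ∀ t' ∈ Ioc (0 : ℝ) θ.γ, ∀ (old : OlderTerms (F.P K) 𝔸 M k), Adm K k old → ∀ (X : (domSys (F.P K) M (k + 1)).Dom), ∀ φ ∈ sp K k X,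
      ‖((Gn K) k).E ((t : ℝ) : ℂ) old φ X - ((Gn K) k).E ((t' : ℝ) : ℂ) old φ X‖ ≤ Real.exp (-(κE * (domSys (F.P K) M (k + 1)).dj X)) * (lam K k * |t - t'|))
    (hlam : ∀ K k, lam K k ≤ ℓ₁) (hℓ₁ : 0 ≤ ℓ₁)
    (hG2last : ∀ (K k : ℕ) (old : OlderTerms (F.P K) 𝔸 M k), Adm K k old → ∀ (t d : ℝ), 0 < d → t - d ∈ Ioc (0 : ℝ) θ.γ → t + d ∈ Ioc (0 : ℝ) θ.γ →
      ∀ (X : (domSys (F.P K) M (k + 1)).Dom), ∀ φ ∈ sp K k X,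
        ‖((Gn K) k).E ((t + d : ℝ) : ℂ) old φ X - 2 * ((Gn K) k).E ((t : ℝ) : ℂ) old φ X + ((Gn K) k).E ((t - d : ℝ) : ℂ) old φ X‖ ≤
          Real.exp (-(κE * (domSys (F.P K) M (k + 1)).dj X)) * (lam₂ K k * d ^ 2))
    (hlam₂ : ∀ K k, lam₂ K k ≤ ℓ₂) (hℓ₂ : 0 ≤ ℓ₂) (hω₁ : 0 ≤ ω₁) (hω₁1 : ω₁ ≤ 1) (hν : ω₁ + 4 * Mb * cw / ϱ < ν)
    (hμν : (ω₁ + 4 * Mb * cw / ϱ) ^ 2 ≤ ν) (hν1 : 1 ≤ ν)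
    (hbd : ∀ g ∈ Window θ.γ, ∀ (K k : ℕ) (X : (domSys (F.P K) M (k + 1)).Dom), ∀ φ ∈ sp K k X,
      ‖(truncRun K (toClusterTower (Gn K)) k).E (histPrefix g k) φ X‖ ≤ B * Real.exp (-(κE * (domSys (F.P K) M (k + 1)).dj X)))
    (Ec : ℕ → ℕ → Type*) [∀ K k, NormedAddCommGroup (Ec K k)] [∀ K k, NormedSpace ℂ (Ec K k)]
    (ι : letI := θ.instVβ₁; letI := θ.instVβ₂
      (K k : ℕ) → (domSys (F.P K) M (k + 1)).Dom → ((Fin (F.P K).d → Site (F.P K) (k + 1) → θ.Vβ) →L[ℝ] Ec K k))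
    (Φ : (K k : ℕ) → (domSys (F.P K) M (k + 1)).Dom → Ec K k → CPair (F.P K) 𝔸)
    (U : (K k : ℕ) → (domSys (F.P K) M (k + 1)).Dom → Set (Ec K k)) (hU : ∀ K k X, IsOpen (U K k X)) (hrU : ∀ K k X, ball (0 : Ec K k) r ⊆ U K k X)
    (hEhol : ∀ g ∈ Window θ.γ, ∀ (K k : ℕ) (X : (domSys (F.P K) M (k + 1)).Dom),
      DifferentiableOn ℂ (fun z => (truncRun K (toClusterTower (Gn K)) k).E (histPrefix g k) (Φ K k X z) X) (U K k X))
    (hΦemb : letI := θ.instVβ₁; letI := θ.instVβ₂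
      ∀ (K k : ℕ) (X : (domSys (F.P K) M (k + 1)).Dom) (Bf : Fin (F.P K).d → Site (F.P K) (k + 1) → θ.Vβ),
        Φ K k X (ι K k X Bf) = emb K k (fun l t => NormedSpace.exp (θ.ρ8 (Bf l t))))
    (hΦsp : ∀ (K k : ℕ) (X : (domSys (F.P K) M (k + 1)).Dom), ∀ z ∈ ball (0 : Ec K k) r, Φ K k X z ∈ sp K k X)
    (w : (K k : ℕ) → (domSys (F.P K) M (k + 1)).Dom → Site (F.P K) (k + 1) → ℝ) (hw₀ : ∀ K k X t, 0 ≤ w K k X t)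
    (hw : letI := θ.instVβ₁; letI := θ.instVβ₂; letI := θ.instιβ
      ∀ (K k : ℕ) (X : (domSys (F.P K) M (k + 1)).Dom) (l : Fin (F.P K).d) (t : Site (F.P K) (k + 1)) (c : θ.ιβ),
        ‖ι K k X (Pi.single l (Pi.single t (θ.bV c)))‖ ≤ w K k X t)
    (htail : ∀ (K k : ℕ) (X : (domSys (F.P K) M (k + 1)).Dom) (t : Site (F.P K) (k + 1)),
      let e : Site (F.P K) (k + 1) → TPt 4 (domCount (F.P K) M (k + 1) * M) := fun x i => (ZMod.cast (x i) : ZMod (domCount (F.P K) M (k + 1) * M))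
      w K k X t ≤ B₃ * Real.exp (-δ₀ * distCT (domCount (F.P K) M (k + 1)) M (e t) (nearT (M := M) (e t) X)))
    (hκ₅ : delta1 δ₀ κ ((M : ℝ) * 4) ≤ κ₅)
    (hω : 0 < ℓ.ω) (hθω : ℓ.θ₅ * ν ≤ ℓ.ω ^ 2) (hℓκ : ℓ.κ ≤ delta1 δ₀ κ ((M : ℝ) * 4))
    (hC₉ : (4 * (2 * C₅ / (1 - ℓ.θ₅) + 2 * ((16 * B * B₃ ^ 2 / r ^ 2) * Real.exp (delta1 δ₀ κ ((M : ℝ) * 4) * ((M : ℝ) * 4) * 3) * K₀ (4 * 2 ^ 4) (2 * 4) * K₁ 4 (δ₀ / 2))) / θ.γ +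
        ((16 * max ℓ₂ (64 * Mb * cw ^ 2 / ϱ ^ 2 * ℓ₁ ^ 2 / (ν - ω₁ - 4 * Mb * cw / ϱ)) * B₃ ^ 2 / r ^ 2) * Real.exp (delta1 δ₀ κ ((M : ℝ) * 4) * ((M : ℝ) * 4) * 3) * K₀ (4 * 2 ^ 4) (2 * 4) *
          K₁ 4 (δ₀ / 2)) * θ.γ / 2) / ℓ.ω ≤ ℓ.C₉) (k : ℕ) :
    N22At (rateCarriersOfRecord₁₃CoPH 𝔯 F θ hP g₀ os k).u3 :=
  n22At_rateCarriers_of_kernels_pin_of_ne9 𝔯 θ hP g₀ os ℓ hs hpin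
    (ne9_EA_objectsOfRecord₁₃_of_kernelStepRate_genAnalyticReading F N θ.toStage13Params ℓ hs hγ hlim hC₅ h5 m' M hM Gn emb hloc sp hκ₀ hδ₀ hB₃ hr hB hκE Adm hAdm ρA A hGA hA hMbA
      hAdmr hρ₁ hρ₂ haw haw0 hawω hcw hMb0 hϱ hR hGt hlam hℓ₁ hG2last hlam₂ hℓ₂ hω₁ hω₁1 hν hμν hν1 hbd Ec ι Φ U hU hrU hEhol hΦemb hΦsp w hw₀ hw htail hκ₅ hω hθω hℓκ hC₉) k

end YMDAG.N22.KernelFading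

end
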